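import Literature.AlgebraicGeometry.Motives.MixedHodgeStructureGrWConservative
import Literature.AlgebraicGeometry.Motives.MixedHodgeStructureLerayAssembly
import Literature.AlgebraicGeometry.Motives.MixedHodgeStructureSubobjects
import HarnessLib

/-!
# Graded pieces of sub-objects, quotients and of the weight steps `W_j H`, `H / W_j H`

Cattani–El Zein–Griffiths–Lê, *Hodge Theory*, Cor. 3.2.21 (ii): "The functor `Gr^W_n` from the category
of MHS to the category `A ⊗ ℚ` HS of weight `n` is exact"; Lemma 3.2.20: sub-objects carry the induced,
quotients the quotient filtrations; Prop. 3.2.19: `W_n = ⊕_{p+q ≤ n} I^{p,q}`. Deligne, *Théorie de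
Hodge II*, Thm. 2.3.5 (iv).

For a sub-MHS `S ⊆ H` (`SubMixedHodgeStructure`, quotient `S.quotient`, `Motives/MixedHodgeStructureAbelian`)
and the exactness of `Gr^W_k` on arbitrary exact pairs (`Hom.exact_grMap`,
`Motives/MixedHodgeStructureGrWConservative`) this file records:

* §1 **`0 → Gr^W_k S → Gr^W_k H → Gr^W_k(H/S) → 0` is short exact** (the tree's
  `grMap_subtype_injective` of `Motives/MixedHodgeStructureLerayAssembly`, `exact_grMap_subtype_mkQ`,
  `grMap_mkQ_surjective`), hence
  **`dim Gr^W_k S + dim Gr^W_k (H/S) = dim Gr^W_k H`** (`finrank_grW_sub_add_finrank_grW_quotient`).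
* §2 for the weight steps `S = W_j H`: **`Gr^W_k(W_j H) ⥲ Gr^W_k H` for `k ≤ j`** and `Gr^W_k(W_j H) = 0`
  for `k > j` (`weight_grMap_subtype_bijective`, `subsingleton_grW_weight`); **`Gr^W_k H ⥲ Gr^W_k(H/W_j H)`
  for `k > j`** and `Gr^W_k(H/W_j H) = 0` for `k ≤ j` (`weight_grMap_mkQ_bijective`,
  `subsingleton_grW_weight_quotient`); the weight filtrations of `W_j H` and `H / W_j H`
  (`weight_toMixedHodgeStructure_W_of_le`, `weight_quotient_W_of_le`).

All statements proved; no definitions, no named facts.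

## References

* [CattaniElZeinGriffithsLe2014] E. Cattani et al. (eds.), Hodge Theory (2014), Cor. 3.2.21 (ii),
  Lemma 3.2.20, Prop. 3.2.19.
* [DeligneHodgeII1971] P. Deligne, Théorie de Hodge II, Publ. Math. IHÉS 40 (1971), Thm. 2.3.5 (iv).
-/

noncomputable section

namespace Literature.AlgebraicGeometry.Motives

namespace MixedHodgeStructure

namespace SubMixedHodgeStructure

universe u

variable {V : Type u} [AddCommGroup V] [Module ℚ V] {H : MixedHodgeStructure V}

open Module

/-! ### §1 `Gr^W_k` of `0 → S → H → H/S → 0` -/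

/-- `Gr^W_k(H ↠ H/S)` is surjective. [cite: CattaniElZeinGriffithsLe2014, Cor. 3.2.21 (ii)] -/
theorem grMap_mkQ_surjective (S : SubMixedHodgeStructure H) (k : ℤ) :
    Function.Surjective (S.mkQ.grMap k) :=
  S.mkQ.grMap_surjective S.mkQ_surjective k

/-- **`Gr^W_k S → Gr^W_k H → Gr^W_k(H/S)` is exact** (`Gr^W_k` is an exact functor).
[cite: CattaniElZeinGriffithsLe2014, Cor. 3.2.21 (ii)] -/
theorem exact_grMap_subtype_mkQ (S : SubMixedHodgeStructure H) (k : ℤ) :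
    Function.Exact (S.subtype.grMap k) (S.mkQ.grMap k) :=
  Hom.exact_grMap S.subtype S.mkQ S.exact_subtype_mkQ k

/-- The kernel of `Gr^W_k(H ↠ H/S)` is the image of `Gr^W_k S`. [cite: CattaniElZeinGriffithsLe2014, Cor. 3.2.21 (ii)] -/
theorem ker_grMap_mkQ (S : SubMixedHodgeStructure H) (k : ℤ) :
    LinearMap.ker (S.mkQ.grMap k) = LinearMap.range (S.subtype.grMap k) :=
  LinearMap.exact_iff.1 (S.exact_grMap_subtype_mkQ k)

/-- **`dim Gr^W_k S + dim Gr^W_k(H/S) = dim Gr^W_k H`.** [cite: CattaniElZeinGriffithsLe2014, Cor. 3.2.21 (ii)] -/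
theorem finrank_grW_sub_add_finrank_grW_quotient [FiniteDimensional ℚ V] (S : SubMixedHodgeStructure H) (k : ℤ) :
    finrank ℚ (grW S.toMixedHodgeStructure.W k) + finrank ℚ (grW S.quotient.W k) = finrank ℚ (grW H.W k) := by
  have h1 := (S.mkQ.grMap k).finrank_range_add_finrank_ker
  rw [LinearMap.range_eq_top.2 (S.grMap_mkQ_surjective k), finrank_top, ker_grMap_mkQ,
    LinearMap.finrank_range_of_inj (S.grMap_subtype_injective k)] at h1
  omega

/-! ### §2 The weight steps `W_j H` and `H / W_j H` -/

/-- The weight filtration of the sub-MHS `W_j H`: `W_k(W_j H) = everything` for `j ≤ k`.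
[cite: CattaniElZeinGriffithsLe2014, Prop. 3.2.19] -/
theorem weight_toMixedHodgeStructure_W_of_le (H : MixedHodgeStructure V) {j k : ℤ} (hjk : j ≤ k) :
    (weight H j).toMixedHodgeStructure.W k = ⊤ := by
  rw [eq_top_iff]
  intro x _
  exact H.monotone_W hjk x.2

/-- The weight filtration of the quotient `H / W_j H` vanishes up to `j`. [cite: CattaniElZeinGriffithsLe2014, Prop. 3.2.19] -/
theorem weight_quotient_W_of_le (H : MixedHodgeStructure V) {j k : ℤ} (hkj : k ≤ j) :
    (weight H j).quotient.W k = ⊥ := by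
  rw [quotient_W, eq_bot_iff]
  rintro _ ⟨x, hx, rfl⟩
  rw [Submodule.mem_bot]
  exact (Submodule.Quotient.mk_eq_zero _).2 (H.monotone_W hkj hx)

/-- **`Gr^W_k(W_j H) → Gr^W_k H` is surjective for `k ≤ j`** (`W_k H ⊆ W_j H`).
[cite: CattaniElZeinGriffithsLe2014, Prop. 3.2.19] -/
theorem weight_grMap_subtype_surjective (H : MixedHodgeStructure V) {j k : ℤ} (hkj : k ≤ j) :
    Function.Surjective ((weight H j).subtype.grMap k) := by
  intro y
  induction y using Submodule.Quotient.induction_on with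
  | _ x => exact ⟨Submodule.Quotient.mk ⟨⟨x, H.monotone_W hkj x.2⟩, x.2⟩, rfl⟩

/-- **`Gr^W_k(W_j H) ⥲ Gr^W_k H` for `k ≤ j`.** [cite: CattaniElZeinGriffithsLe2014, Prop. 3.2.19] -/
theorem weight_grMap_subtype_bijective (H : MixedHodgeStructure V) {j k : ℤ} (hkj : k ≤ j) :
    Function.Bijective ((weight H j).subtype.grMap k) :=
  ⟨(weight H j).grMap_subtype_injective k, weight_grMap_subtype_surjective H hkj⟩

/-- **`Gr^W_k(W_j H) = 0` for `k > j`.** [cite: CattaniElZeinGriffithsLe2014, Prop. 3.2.19] -/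
theorem subsingleton_grW_weight (H : MixedHodgeStructure V) {j k : ℤ} (hjk : j < k) :
    Subsingleton (grW (weight H j).toMixedHodgeStructure.W k) := by
  rw [subsingleton_grW_iff, weight_toMixedHodgeStructure_W_of_le H (show j ≤ k - 1 by omega)]
  exact le_top

/-- **`Gr^W_k H ⥲ Gr^W_k(H/W_j H)` for `k > j`**: `Gr^W_k(H ↠ H/W_j H)` is injective for `k > j` (its kernel
is `(W_j ∩ W_k + W_{k-1})/W_{k-1} = 0`) and always surjective. [cite: CattaniElZeinGriffithsLe2014, Cor. 3.2.21 (ii)] -/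
theorem weight_grMap_mkQ_bijective (H : MixedHodgeStructure V) {j k : ℤ} (hjk : j < k) :
    Function.Bijective ((weight H j).mkQ.grMap k) := by
  refine ⟨?_, (weight H j).grMap_mkQ_surjective k⟩
  rw [← LinearMap.ker_eq_bot, eq_bot_iff]
  intro y hy
  induction y using Submodule.Quotient.induction_on with
  | _ x =>
    rw [LinearMap.mem_ker, Hom.grMap_mk_eq_zero_iff] at hy
    rw [Submodule.mem_bot, grW_mk_eq_zero_iff]
    have hker : LinearMap.ker (weight H j).mkQ.toLinearMap = H.W j := Submodule.ker_mkQ _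
    rw [hker] at hy
    obtain ⟨a, ha, b, hb, hab⟩ := Submodule.mem_sup.1 hy
    rw [← hab]
    exact Submodule.add_mem _ (H.monotone_W (show j ≤ k - 1 by omega) ha.1) hb

/-- **`Gr^W_k(H/W_j H) = 0` for `k ≤ j`.** [cite: CattaniElZeinGriffithsLe2014, Prop. 3.2.19] -/
theorem subsingleton_grW_weight_quotient (H : MixedHodgeStructure V) {j k : ℤ} (hkj : k ≤ j) :
    Subsingleton (grW (weight H j).quotient.W k) := by
  rw [subsingleton_grW_iff, weight_quotient_W_of_le H hkj]
  exact bot_le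

/-- `dim Gr^W_k(W_j H) = dim Gr^W_k H` for `k ≤ j`. [cite: CattaniElZeinGriffithsLe2014, Prop. 3.2.19] -/
theorem finrank_grW_weight_of_le [FiniteDimensional ℚ V] (H : MixedHodgeStructure V) {j k : ℤ} (hkj : k ≤ j) :
    finrank ℚ (grW (weight H j).toMixedHodgeStructure.W k) = finrank ℚ (grW H.W k) :=
  LinearEquiv.finrank_eq (LinearEquiv.ofBijective _ (weight_grMap_subtype_bijective H hkj))

/-- `dim Gr^W_k(H/W_j H) = dim Gr^W_k H` for `k > j`. [cite: CattaniElZeinGriffithsLe2014, Cor. 3.2.21 (ii)] -/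
theorem finrank_grW_weight_quotient_of_lt [FiniteDimensional ℚ V] (H : MixedHodgeStructure V) {j k : ℤ}
    (hjk : j < k) : finrank ℚ (grW (weight H j).quotient.W k) = finrank ℚ (grW H.W k) :=
  (LinearEquiv.finrank_eq (LinearEquiv.ofBijective _ (weight_grMap_mkQ_bijective H hjk))).symm

end SubMixedHodgeStructure

end MixedHodgeStructure

end Literature.AlgebraicGeometry.Motives
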